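import Literature.NumberTheory.NumberFields.NumberFieldIsomorphismP
import Literature.Computability.Complexity.NumberFieldIsomorphism
import Literature.Computability.Complexity.CanonicalCodes
import Literature.Computability.Complexity.ListFoldChecks
import HarnessLib

/-!
# Number-field isomorphism in `P`: the two vendored forms of the fact agree

The tree vendors the theorem "isomorphism of number fields given by defining polynomials is
decidable in deterministic polynomial time" (A. K. Lenstra 1983, Thm. (3.7); Landau 1985;
H. W. Lenstra 1992, §2.9; Cohen GTM 138, §4.5.4) TWICE, as named facts over two codings of the
same decision problem:

* `Literature.NumberTheory.NumberFields.nfIso_mem_P` (`NumberFieldIsomorphismP.lean`):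
  `nfIsoLang ∈ P`, where `nfIsoLang` consists of the pair codes `⟨code p, code q⟩` of the EXACT
  (canonical) codes `encodingIntPoly.encode` of monic irreducible `p, q ∈ ℤ[X]` with
  `ℚ[X]/(p) ≃ₐ[ℚ] ℚ[X]/(q)`;
* `Literature.Computability.Complexity.lenstra_numberFieldIso_mem_P`
  (`Computability/Complexity/NumberFieldIsomorphism.lean`): `NFIsoLang ∈ P`, where `NFIsoLang`
  consists of the pairs `⟨u, v⟩` of ANY strings that DECODE (`polyDecode`, a total reading: every
  string decodes to some integer list, read as a coefficient list) to such `p, q`.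

This file proves, sorry-free and without new named facts, that the second form implies the first
(`nfIso_mem_P_of_lenstra_numberFieldIso_mem_P`), and likewise for the companion facts on
irreducibility (`monicIrredLang_mem_P_of_lll_monicIrreducible_mem_P`:
`lll_monicIrreducible_mem_P → monicIrredLang ∈ P`). The content is routine coding theory
(Arora–Barak 2009, §0.1–§1.3): the two codings have literally the same decoder
(`polyDecode_eq_decode`), so `nfIsoLang = NFIsoLang ∩ {both components are canonical codes}`
(`nfIsoLang_eq_inter`), and **the set of canonical polynomial codes is in `P`**
(`range_encode_mem_P`): a string `u` is `encodingIntPoly.encode p` for some `p` iff it is a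
canonical integer-list code (`CanonCode.canonListFn canonIntFn u = u`, the tree's polynomial-time
re-encoding `encode ∘ decode` of `CanonicalCodes.lean`) whose item list is a genuine ascending
coefficient list — it is `[0]`, or its last item is not the code of `0` (`range_encode_eq`); the
last item of a coded list is read by the fold brick `lastItemF` (`Brick.foldFn`,
`ListFoldBricks.lean`).

Consequently the number-field half of the `PEq`-witness of `NumberFieldIsomorphismP.lean`
(`nfEquiv_isPEq`) is available from either fact (`nfEquiv_isPEq_of_lenstra_numberFieldIso_mem_P`).

What is NOT here: the decider itself (the polynomial-time factoring machines of LLL 1982 §3 and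
Lenstra 1983 / Landau 1985 in the tree's `TM2` model), i.e. a discharge of either fact.

## References

* A. K. Lenstra, *Factoring polynomials over algebraic number fields*, EUROCAL '83, LNCS 162
  (1983) 245–254 = Math. Centrum report IW 213/82, Thm. (3.7) (PDF p. 21). [Lenstra1983]
* S. Landau, *Factoring polynomials over algebraic number fields*, SIAM J. Comput. 14 (1985)
  184–195. [Landau1985]
* H. W. Lenstra Jr., *Algorithms in algebraic number theory*, Bull. AMS 26 (1992) 211–244, §2.9.
  [Lenstra1992]
* S. Arora, B. Barak, *Computational Complexity: A Modern Approach*, CUP 2009, §0.1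
  (representations of objects as strings), §1.3 (closure properties of `P`). [AroraBarak2009]
-/

open Polynomial

namespace Literature.NumberTheory.NumberFields

open _root_.Computability Literature.Computability.Complexity
  Literature.Computability.Complexity.Brick

/-! ### Dictionary between the two vendored files -/

/-- The two readings of an integer list as a polynomial coincide:
`polyOfList l = ofCoeffsAsc l = ∑ lᵢ Xⁱ`. [folklore] -/
theorem polyOfList_eq_ofCoeffsAsc (l : List ℤ) : polyOfList l = ofCoeffsAsc l := rfl

/-- The two codes of an integer polynomial coincide. [folklore] -/
theorem polyCode_eq_encode (p : ℤ[X]) : polyCode p = encodingIntPoly.encode p := rfl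

/-- The two decoders coincide. [folklore] -/
theorem polyDecode_eq_decode (w : List Bool) : polyDecode w = encodingIntPoly.decode w := rfl

/-- The two isomorphism predicates coincide. [folklore] -/
theorem nfIsomorphic_iff_isoStemFields (p q : ℤ[X]) : NFIsomorphic p q ↔ IsoStemFields p q :=
  Iff.rfl

/-! ### The decoders are total -/

/-- The integer list read off ANY string by `encodingIntBool.listBool.decode` (a total decoder:
header length many items, each read by the total integer decoder `CanonCode.decInt`).
[folklore] -/
def decIntList (w : List Bool) : List ℤ :=
  NegCNF.decList CanonCode.decInt (boolUnpair w).1.length (boolUnpair w).2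

/-- `encodingIntBool.listBool.decode` is total with value `decIntList`. [folklore] -/
theorem listBool_decode_eq_some (w : List Bool) :
    encodingIntBool.listBool.decode w = some (decIntList w) :=
  (CanonCode.canonListFn_eq encodingIntBool CanonCode.decInt CanonCode.decode_int
    CanonCode.canonIntFn_eq w).1

/-- The tree's polynomial-time canonicalisation of integer-list codes is `encode ∘ decode`.
[folklore] -/
theorem canonListFn_canonIntFn_eq (w : List Bool) :
    CanonCode.canonListFn CanonCode.canonIntFn w = encodingIntBool.listBool.encode (decIntList w) :=
  (CanonCode.canonListFn_eq encodingIntBool CanonCode.decInt CanonCode.decode_int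
    CanonCode.canonIntFn_eq w).2

/-- Decoding a genuine list code returns the list. [folklore] -/
theorem decIntList_encode (l : List ℤ) : decIntList (encodingIntBool.listBool.encode l) = l := by
  have h := listBool_decode_eq_some (encodingIntBool.listBool.encode l)
  rw [Encoding.decode_encode] at h
  exact (Option.some_injective _ h).symm

/-- The polynomial read off ANY string: `ofCoeffsAsc` of the decoded integer list. [folklore] -/
noncomputable def decPoly (w : List Bool) : ℤ[X] := ofCoeffsAsc (decIntList w)

/-- `encodingIntPoly.decode` is total with value `decPoly`. [folklore] -/
theorem decode_eq_some_decPoly (w : List Bool) : encodingIntPoly.decode w = some (decPoly w) := by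
  change (encodingIntBool.listBool.decode w).map ofCoeffsAsc = _
  rw [listBool_decode_eq_some]
  rfl

/-- `polyDecode` is total with value `decPoly`. [folklore] -/
theorem polyDecode_eq_some (w : List Bool) : polyDecode w = some (decPoly w) :=
  decode_eq_some_decPoly w

/-- Decoding the code of `p` returns `p`. [folklore] -/
theorem decPoly_encode (p : ℤ[X]) : decPoly (encodingIntPoly.encode p) = p := by
  have h := decode_eq_some_decPoly (encodingIntPoly.encode p)
  rw [encodingIntPoly.decode_encode] at h
  exact (Option.some_injective _ h).symm

/-- `polyDecode u = some p` pins down `p` as `decPoly u`. [folklore] -/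
theorem eq_decPoly_of_polyDecode_eq {u : List Bool} {p : ℤ[X]} (h : polyDecode u = some p) :
    p = decPoly u := by
  rw [polyDecode_eq_some] at h
  exact (Option.some_injective _ h).symm

/-! ### Ascending coefficient lists -/

/-- Coefficients of `ofCoeffsAsc l`: the entries of `l` (zero past the end). [folklore] -/
theorem coeff_ofCoeffsAsc (l : List ℤ) (i : ℕ) : (ofCoeffsAsc l).coeff i = l.getD i 0 := by
  rw [ofCoeffsAsc_eq_sum_range, finsetSum_coeff]
  simp only [coeff_monomial]
  rw [Finset.sum_ite_eq']
  split_ifs with h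
  · rfl
  · rw [Finset.mem_range, not_lt] at h
    exact (List.getD_eq_default _ _ h).symm

/-- `natDegree (ofCoeffsAsc l) ≤ |l| - 1`. [folklore] -/
theorem natDegree_ofCoeffsAsc_le (l : List ℤ) : (ofCoeffsAsc l).natDegree ≤ l.length - 1 := by
  rw [natDegree_le_iff_coeff_eq_zero]
  intro i hi
  rw [coeff_ofCoeffsAsc, List.getD_eq_default _ _ (by omega)]

/-- The last entry of `coeffsAsc p` is the leading coefficient. [folklore] -/
theorem getLast?_coeffsAsc (p : ℤ[X]) : (coeffsAsc p).getLast? = some p.leadingCoeff := by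
  rw [List.getLast?_eq_getElem?, length_coeffsAsc]
  simp [coeffsAsc]

/-- `coeffsAsc 0 = [0]`. [folklore] -/
@[simp] theorem coeffsAsc_zero : coeffsAsc 0 = [0] := by
  simp [coeffsAsc]

/-- A list whose last entry is nonzero is the ascending coefficient list of the polynomial it
defines. [folklore] -/
theorem coeffsAsc_ofCoeffsAsc {l : List ℤ} {a : ℤ} (hl : l.getLast? = some a) (ha : a ≠ 0) :
    coeffsAsc (ofCoeffsAsc l) = l := by
  have hne : l ≠ [] := by rintro rfl; simp at hl
  have hlen : 0 < l.length := List.length_pos_of_ne_nil hne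
  have hlast : l[l.length - 1]? = some a := by rwa [List.getLast?_eq_getElem?] at hl
  have hD : l.getD (l.length - 1) 0 = a := by
    rw [List.getD_eq_getElem?_getD, hlast, Option.getD_some]
  have hdeg : (ofCoeffsAsc l).natDegree = l.length - 1 := by
    refine le_antisymm (natDegree_ofCoeffsAsc_le l) (le_natDegree_of_ne_zero ?_)
    rwa [coeff_ofCoeffsAsc, hD]
  apply List.ext_getElem
  · rw [length_coeffsAsc, hdeg]; omega
  · intro i h₁ h₂
    unfold coeffsAsc
    rw [List.getElem_map, List.getElem_range, coeff_ofCoeffsAsc, List.getD_eq_getElem _ _ h₂]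

/-- **The image of `coeffsAsc`**: an integer list is the ascending coefficient list of some
polynomial iff it is `[0]` or its last entry is nonzero. [folklore] -/
theorem exists_coeffsAsc_eq_iff (l : List ℤ) :
    (∃ p : ℤ[X], coeffsAsc p = l) ↔ l = [0] ∨ ∃ a, l.getLast? = some a ∧ a ≠ 0 := by
  constructor
  · rintro ⟨p, rfl⟩
    by_cases hp : p = 0
    · exact Or.inl (by rw [hp, coeffsAsc_zero])
    · exact Or.inr ⟨p.leadingCoeff, getLast?_coeffsAsc p, leadingCoeff_ne_zero.2 hp⟩
  · rintro (rfl | ⟨a, hl, ha⟩)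
    · exact ⟨0, coeffsAsc_zero⟩
    · exact ⟨ofCoeffsAsc l, coeffsAsc_ofCoeffsAsc hl ha⟩

/-! ### Reading the last item of a coded list in polynomial time -/

/-- **`lastItemF`**: the fold (`Brick.foldFn`) over the items of the coded list in the second
component of the input that keeps the current item; on `⟨x, encList L⟩` it returns the last item
of `L` (`ε` for the empty list). [Arora–Barak 2009, §1.3 (bounded loops)]
[cite: AroraBarak2009, §1.3] -/
noncomputable def lastItemF : List Bool → List Bool := foldFn (nthF 1) fun _ => []

/-- The step of `lastItemF` does not grow the accumulator beyond the item. [folklore] -/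
theorem foldGrowth_nthF_one : FoldGrowth 0 (nthF 1) := by
  intro v
  change (fstF (sndF v)).length ≤ _
  omega

/-- `lastItemF ∈ FP`. [folklore] -/
theorem lastItemF_mem_FP : lastItemF ∈ FP :=
  foldFn_mem_FP (nthF_mem_FP 1) (const_mem_FP _) foldGrowth_nthF_one

/-- Folding "keep the current item" returns the last item. [folklore] -/
theorem foldl_keep_eq_getLastD {α : Type} (l : List α) (b : α) :
    l.foldl (fun _ a => a) b = l.getLastD b := by
  induction l generalizing b with
  | nil => rfl
  | cons a l ih => simp only [List.foldl_cons, List.getLastD_cons, ih]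

/-- **Value of `lastItemF` on a coded list**: the last item (`ε` if there is none). [folklore] -/
theorem lastItemF_boolPair_encList (x : List Bool) (L : List (List Bool)) :
    lastItemF (boolPair x (encList L)) = L.getLastD [] := by
  rw [lastItemF, foldFn_boolPair, decNil_encList]
  simp only [nthF_succ_boolPair, nthF_zero_boolPair]
  exact foldl_keep_eq_getLastD L []

/-- `lastItemF` on a genuine integer-list code: the code of the last entry (`ε` for the empty
list). [folklore] -/
theorem lastItemF_listBool_encode (l : List ℤ) :
    lastItemF (encodingIntBool.listBool.encode l) = (l.map encodingIntBool.encode).getLastD [] := by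
  rw [listBool_encode_eq_encList, lastItemF_boolPair_encList]

/-- The last item of a mapped nonempty list. [folklore] -/
theorem getLastD_map_of_getLast? {l : List ℤ} {a : ℤ} (h : l.getLast? = some a) (d : List Bool) :
    (l.map encodingIntBool.encode).getLastD d = encodingIntBool.encode a := by
  rw [List.getLastD_eq_getLast?, List.getLast?_map, h]
  rfl

/-- No integer is coded by the empty string (the code is the pair of the sign bit and the
binary magnitude, cf. `Literature.Algebra.EuclideanLattices.GMSS.encodingIntBool_encode`, not
imported here). [folklore] -/
theorem encodingIntBool_encode_ne_nil (z : ℤ) : encodingIntBool.encode z ≠ [] := by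
  intro h
  have h' := congrArg List.length h
  rw [show encodingIntBool.encode z = boolPair [decide (z < 0)] (encodeNat z.natAbs) from rfl,
    length_boolPair] at h'
  simp at h'

/-! ### The set of canonical polynomial codes is in `P` -/

/-- **The canonical polynomial codes, recognised**: a string is `encodingIntPoly.encode p` for
some `p ∈ ℤ[X]` iff it is a canonical integer-list code (fixed by the re-encoding
`CanonCode.canonListFn canonIntFn = encode ∘ decode`) which is either the code of `0` or whose
last item is neither absent nor the code of the integer `0`. [Arora–Barak 2009, §0.1]
[cite: AroraBarak2009, §0.1] -/
theorem range_encode_eq :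
    Set.range encodingIntPoly.encode =
      {u | CanonCode.canonListFn CanonCode.canonIntFn u = u} ∩
        ({u | u = encodingIntPoly.encode 0} ∪
          ({u | lastItemF u ≠ []} ∩ {u | lastItemF u ≠ encodingIntBool.encode 0})) := by
  ext u
  simp only [Set.mem_range, Set.mem_inter_iff, Set.mem_union, Set.mem_setOf_eq]
  constructor
  · rintro ⟨p, rfl⟩
    refine ⟨?_, ?_⟩
    · rw [canonListFn_canonIntFn_eq]
      change encodingIntBool.listBool.encode (decIntList (encodingIntBool.listBool.encode _)) = _
      rw [decIntList_encode]
      rfl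
    · by_cases hp : p = 0
      · exact Or.inl (by rw [hp])
      · refine Or.inr ?_
        change lastItemF (encodingIntBool.listBool.encode (coeffsAsc p)) ≠ [] ∧
          lastItemF (encodingIntBool.listBool.encode (coeffsAsc p)) ≠ encodingIntBool.encode 0
        rw [lastItemF_listBool_encode, getLastD_map_of_getLast? (getLast?_coeffsAsc p)]
        exact ⟨encodingIntBool_encode_ne_nil _, fun h =>
          hp (leadingCoeff_eq_zero.1 (encodingIntBool.encode_injective h))⟩
  · rintro ⟨hcanon, h0 | ⟨hne, hne0⟩⟩
    · exact ⟨0, h0.symm⟩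
    · rw [canonListFn_canonIntFn_eq] at hcanon
      rw [← hcanon, lastItemF_listBool_encode] at hne hne0
      have hl : ∃ a, (decIntList u).getLast? = some a ∧ a ≠ 0 := by
        cases h : (decIntList u).getLast? with
        | none =>
          rw [List.getLast?_eq_none_iff] at h
          rw [h] at hne
          exact absurd rfl hne
        | some a =>
          refine ⟨a, rfl, ?_⟩
          rintro rfl
          rw [getLastD_map_of_getLast? h] at hne0
          exact hne0 rfl
      obtain ⟨p, hp⟩ := (exists_coeffsAsc_eq_iff _).2 (Or.inr hl)
      refine ⟨p, ?_⟩
      rw [← hcanon, ← hp]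
      rfl

/-- **The set of canonical polynomial codes is in `P`** (assembled from `P`'s closure under
intersection, union, complement, and the equaliser languages `{u | f u = g u}` of `FP` functions).
[Arora–Barak 2009, §1.3] [cite: AroraBarak2009, §1.3] -/
theorem range_encode_mem_P : Set.range encodingIntPoly.encode ∈ Classes.P := by
  rw [range_encode_eq]
  refine inter_mem_P ?_ (union_mem_P ?_ (inter_mem_P ?_ ?_))
  · exact setOf_apply_eq_apply_mem_P
      (CanonCode.canonListFn_mem_FP CanonCode.canonIntFn_mem_FP CanonCode.length_canonIntFn_le)
      (PolyTimeComputable.id _)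
  · exact setOf_apply_eq_apply_mem_P (PolyTimeComputable.id _) (const_mem_FP _)
  · exact compl_mem_P_iff.2 (setOf_apply_eq_apply_mem_P lastItemF_mem_FP (const_mem_FP []))
  · exact compl_mem_P_iff.2
      (setOf_apply_eq_apply_mem_P lastItemF_mem_FP (const_mem_FP (encodingIntBool.encode 0)))

/-! ### The two languages, compared -/

/-- **`nfIsoLang` is `NFIsoLang` cut down to canonical codes**: a string lies in `nfIsoLang` iff
it lies in `NFIsoLang` and both of its pair components are canonical polynomial codes.
[folklore] -/
theorem nfIsoLang_eq_inter :
    nfIsoLang = NFIsoLang ⊓ ((fstF ⁻¹' Set.range encodingIntPoly.encode : Language Bool) ⊓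
      (sndF ⁻¹' Set.range encodingIntPoly.encode : Language Bool)) := by
  ext w
  change w ∈ nfIsoLang ↔ w ∈ NFIsoLang ∧ fstF w ∈ Set.range encodingIntPoly.encode ∧
    sndF w ∈ Set.range encodingIntPoly.encode
  constructor
  · rintro ⟨⟨p, q⟩, ⟨hp, hq, hiso⟩, rfl⟩
    change boolPair (encodingIntPoly.encode p) (encodingIntPoly.encode q) ∈ NFIsoLang ∧
      fstF (boolPair (encodingIntPoly.encode p) (encodingIntPoly.encode q)) ∈ _ ∧
      sndF (boolPair (encodingIntPoly.encode p) (encodingIntPoly.encode q)) ∈ _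
    rw [fstF_boolPair, sndF_boolPair]
    refine ⟨⟨_, _, p, q, rfl, ?_, ?_, hp.1, hp.2, hq.1, hq.2, hiso⟩, ⟨p, rfl⟩, ⟨q, rfl⟩⟩
    · rw [polyDecode_eq_some, decPoly_encode]
    · rw [polyDecode_eq_some, decPoly_encode]
  · rintro ⟨⟨u, v, p, q, rfl, hu, hv, hpm, hpi, hqm, hqi, hiso⟩, ⟨p', hp'⟩, ⟨q', hq'⟩⟩
    rw [fstF_boolPair] at hp'
    rw [sndF_boolPair] at hq'
    subst hp' hq'
    rw [eq_decPoly_of_polyDecode_eq hu, decPoly_encode] at hpm hpi hiso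
    rw [eq_decPoly_of_polyDecode_eq hv, decPoly_encode] at hqm hqi hiso
    exact (boolPair_encode_mem_nfIsoLang_iff p' q').2 ⟨⟨hpm, hpi⟩, ⟨hqm, hqi⟩, hiso⟩

/-- **`monicIrredLang` is `MonicIrreducibleLang` cut down to canonical codes.** [folklore] -/
theorem monicIrredLang_eq_inter :
    monicIrredLang = MonicIrreducibleLang ⊓ (Set.range encodingIntPoly.encode : Language Bool) := by
  ext u
  change u ∈ monicIrredLang ↔ u ∈ MonicIrreducibleLang ∧ u ∈ Set.range encodingIntPoly.encode
  constructor
  · rintro ⟨p, hp, rfl⟩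
    exact ⟨⟨p, by rw [polyDecode_eq_some, decPoly_encode], hp.1, hp.2⟩, ⟨p, rfl⟩⟩
  · rintro ⟨⟨p, hu, hpm, hpi⟩, ⟨p', rfl⟩⟩
    rw [eq_decPoly_of_polyDecode_eq hu, decPoly_encode] at hpm hpi
    exact ⟨p', ⟨hpm, hpi⟩, rfl⟩

/-! ### The facts of `NumberFieldIsomorphism.lean` imply those of `NumberFieldIsomorphismP.lean` -/

/-- **`lenstra_numberFieldIso_mem_P → nfIso_mem_P`**: the decode-based form of "number-field
isomorphism is in `P`" (A. K. Lenstra 1983, Thm. (3.7); Landau 1985; Lenstra 1992, §2.9) implies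
the exact-code form, by `P`'s closure under intersection and `FP`-preimages and
`range_encode_mem_P`. [cite: Lenstra1983, Thm. (3.7)] -/
theorem nfIso_mem_P_of_lenstra_numberFieldIso_mem_P (h : lenstra_numberFieldIso_mem_P) :
    nfIso_mem_P := by
  unfold nfIso_mem_P
  rw [nfIsoLang_eq_inter]
  exact inter_mem_P h (inter_mem_P (preimage_mem_P range_encode_mem_P fstF_mem_FP)
    (preimage_mem_P range_encode_mem_P sndF_mem_FP))

/-- **`lll_monicIrreducible_mem_P → monicIrredLang ∈ P`**: the decode-based form of
"irreducibility (with monicity) of integer polynomials is in `P`" (LLL 1982, Thm. (3.6)) implies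
the exact-code form. [cite: LenstraLenstraLovasz1982, Thm. (3.6)] -/
theorem monicIrredLang_mem_P_of_lll_monicIrreducible_mem_P (h : lll_monicIrreducible_mem_P) :
    monicIrredLang ∈ Classes.P := by
  rw [monicIrredLang_eq_inter]
  exact inter_mem_P h range_encode_mem_P

/-- **The `PEq` witness from the decode-based fact**: under `lenstra_numberFieldIso_mem_P`,
`nfEquiv` is an equivalence relation on bit strings whose pair-language is in `P`
(`nfEquiv_isPEq` composed with `nfIso_mem_P_of_lenstra_numberFieldIso_mem_P`).
[cite: Lenstra1992, §2.9] -/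
theorem nfEquiv_isPEq_of_lenstra_numberFieldIso_mem_P (h : lenstra_numberFieldIso_mem_P) :
    Equivalence nfEquiv ∧
      ({w | ∃ x y, w = boolPair x y ∧ nfEquiv x y} : Language Bool) ∈ Classes.P :=
  nfEquiv_isPEq (nfIso_mem_P_of_lenstra_numberFieldIso_mem_P h)

end Literature.NumberTheory.NumberFields
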